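import Mathlib
import Summits.ResolutionOfSingularities.ResolutionOfSingularities.Theorems.RadicialJungCleanModelsCleanProp44SectionPointIntrinsic
import Summits.ResolutionOfSingularities.ResolutionOfSingularities.Theorems.RadicialJungCleanModelsCleanProp44BirthDescentOfFace
import HarnessLib

/-!
# Route `RadicialJung`, crux `CleanModels` (stmt-ResolutionOfSingularities-15917), line `Sketch` rev 35, stub 6 `stub_cleanProp44` (X44c):
# THE `δ`-DESCENT OF ONE GENERATION FROM STALK-NATURAL INPUTS — the two entry points the termination author chains after ✓ `tower_face`

Seat decomp-res-hand-2 g21 (structural hand); capstone of ✓ `…SuccessorCount`, ✓ `…DescentAtBirth`, ✓ `…SectionPointIntrinsic`.  Memo 4e §2.5 CONCLUSION (B′) for ONE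
generation, in surrogate currency, with every input phrased as the hands' scheme files produce them (regular systems of parameters at points, ring maps of stalks, orders):

* `exists_successor_intrinsic` — **STEP 1, at the generic point `η″` of the near curve `Γ″ ⊂ E`**: the face `Φ ∈ κ(c)[u][T]` (✓ `tower_face`: `deg_T Φ ≤ μ`, constant top
  coefficient `c ≠ 0`, `deg_u Φ_0 ≤ μδ`), `p ∣ δ`, a prime `π` of `κ[u][T]` and a ring map `ρ : κ[u][T] → D` into a DVR (`D = 𝒪_{E,η″}`) with `𝔫_D = (ρπ)`, `ρ⁻¹𝔫_D = (π)`
  and `ρΦ ∈ 𝔫_D^μ` («the transform keeps order `μ` along `Γ″`», restricted to `E`) ⟹ `π = a(T + λ)`, `Φ = c(T + λ)^μ`, `deg λ ≤ δ`, `deg λ′ ≤ δ − 2`.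
* `birth_descent_intrinsic` — **STEP 2, at the births `c′_i ∈ Γ″`** (closed points `P_i` of the base line, pairwise distinct): for each `i` the regular two-dimensional
  local ring `S_i = 𝒪_{E,c′_i}` with a `κ[u][T]`-algebra structure whose maximal ideal is `(P_i, T + λ)S_i` (`hli` form), residue classes polynomials in `u`, the new
  leaf `w_i = v(c)·T − G_i^p ∈ 𝔫_{S_i}` and the new surrogate «`δ′_i ≥ d′_i`» read along `K_i = V(w_i)` (`c(T+λ)^μ ∈ (w_i) + 𝔫_{S_i}^{μ d′_i}`); if `λ′ ≠ 0`:
  `Σ_i (d′_i − 1)·deg P_i ≤ δ − 2` and `d′_i ≤ δ − 1` for every `i` — «`δ*(c′) ≤ δ*(c) − 1`, branching `≤ δ* − 2`».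
* `birth_descent_intrinsic_perfect` — over a perfect `κ(c)`: the same OR `(−v(c))λ` is a `p`-th power (no birth on `Γ″`).

What the scheme side (census (S)) still owes, per generation: the tower data for ✓ `tower_face` (S1), the maps `κ(c)[u][T] → 𝒪_{E,η″}`, `→ 𝒪_{E,c′_i}` with the
stated r.s.p./residue properties (S2, now WITHOUT localization facts), `ρΦ ∈ 𝔫^μ` (S3), `w_i ∈ 𝔫` and the surrogates (S4).  Honest framing: OURS, composition; (B5′)
untouched; nothing here proves X44c, any case of `CleanModels`, or resolution of singularities in characteristic `p`.
[cite: CossartPiltant2008, Lemma 4.3 (4)–(5); Prop. 4.4 (proof, p. 11)] [cite: CossartPiltant2009, ch.1 II.5.3.2 (i)] [cite: CossartJannsenSaito2020, Lemma 7.5]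
-/

noncomputable section

set_option linter.dupNamespace false -- mandated namespace of this single-conjunct summit

open Polynomial IsLocalRing Literature.AlgebraicGeometry.Resolution

namespace Summit.ResolutionOfSingularities.ResolutionOfSingularities.Theorems.RadicialJung.CleanModels

section Intrinsic

variable {k : Type*} [Field k]

/-- **STEP 1 — the successor line from the generic point of the near curve** (see the module docstring). [cite: CossartPiltant2008, Lemma 4.3 (5); Prop. 4.4 (proof, p. 11)] -/
theorem exists_successor_intrinsic {Φ π : (k[X])[X]} {μ δ : ℕ} (hμ : 1 ≤ μ) (hdeg : Φ.natDegree ≤ μ) {c : k} (hc : c ≠ 0)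
    (htop : Φ.coeff μ = C c) (hC0 : (Φ.coeff 0).natDegree ≤ μ * δ) (hδ : (δ : k) = 0) (hπ : Prime π)
    {D : Type*} [CommRing D] [IsDomain D] [IsDiscreteValuationRing D] (ρ : (k[X])[X] →+* D)
    (hunif : maximalIdeal D = Ideal.span {ρ π}) (hcomap : (maximalIdeal D).comap ρ = Ideal.span {π})
    (hΦ : ρ Φ ∈ maximalIdeal D ^ μ) :
    ∃ (a : k) (lam : k[X]), a ≠ 0 ∧ π = C (C a) * (X + C lam) ∧ Φ = C (C c) * (X + C lam) ^ μ ∧ lam.natDegree ≤ δ ∧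
      (derivative lam).natDegree ≤ δ - 2 :=
  exists_successor_of_solvableFace hμ hdeg hc htop hπ.not_unit
    (pow_dvd_of_map_mem_maximalIdeal_pow_of_comap ρ hunif hcomap μ Φ hΦ) hC0 hδ

variable (p : ℕ) [Fact p.Prime] [CharP k p]
variable {ι : Type*} (s : Finset ι) (Si : ι → Type*) [∀ i, CommRing (Si i)] [∀ i, Algebra (k[X])[X] (Si i)]
  [∀ i, IsRegularLocalRing (Si i)]

/-- **STEP 2 — THE `δ`-DESCENT AT THE BIRTHS, stalk-natural inputs** (see the module docstring). [cite: CossartPiltant2008, Prop. 4.4 (proof, p. 11)]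
[cite: CossartPiltant2009, ch.1 II.5.3.2 (i)] -/
theorem birth_descent_intrinsic {c : k} (hc : c ≠ 0) {a₀ : k} (ha₀ : a₀ ≠ 0) (lam : k[X]) {μ δ : ℕ} (hμ : 0 < μ)
    (hlam : lam.natDegree ≤ δ) (hδ : (δ : k) = 0) (hlam' : derivative lam ≠ 0)
    (P : ι → k[X]) (hP : ∀ i ∈ s, Prime (P i)) (hne : ∀ i ∈ s, ∀ j ∈ s, i ≠ j → ¬ P i ∣ P j)
    (G : ∀ i, Si i) (d' : ι → ℕ) (hd'1 : ∀ i ∈ s, 1 ≤ d' i)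
    (h𝔫eq : ∀ i ∈ s, maximalIdeal (Si i) = (Ideal.span ({C (P i), X + C lam} : Set (k[X])[X])).map (algebraMap (k[X])[X] (Si i)))
    (hres : ∀ i ∈ s, ∀ z : Si i, ∃ g : k[X], z - algebraMap (k[X])[X] (Si i) (C g) ∈ maximalIdeal (Si i))
    (hli : ∀ i ∈ s, ∀ α β : Si i, α * algebraMap (k[X])[X] (Si i) (C (P i)) + β * algebraMap (k[X])[X] (Si i) (X + C lam) ∈
      maximalIdeal (Si i) ^ 2 → α ∈ maximalIdeal (Si i) ∧ β ∈ maximalIdeal (Si i))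
    (hdim : ∀ i ∈ s, ringKrullDim (Si i) = 2)
    (hw𝔫 : ∀ i ∈ s, algebraMap (k[X])[X] (Si i) (C (C a₀) * X) - G i ^ p ∈ maximalIdeal (Si i))
    (hf : ∀ i ∈ s, algebraMap (k[X])[X] (Si i) (C (C c) * (X + C lam) ^ μ) ∈
      Ideal.span {algebraMap (k[X])[X] (Si i) (C (C a₀) * X) - G i ^ p} ⊔ maximalIdeal (Si i) ^ (μ * d' i)) :
    (∑ i ∈ s, (d' i - 1) * (P i).natDegree ≤ δ - 2) ∧ ∀ i ∈ s, d' i ≤ δ - 1 := by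
  have hbirth : ∀ i ∈ s, ∃ g : k[X], C (-a₀) * lam * 1 ^ p + (-g) ^ p ∈ Ideal.span {P i} ^ d' i := fun i hi =>
    descent_at_birth_intrinsic (P i) lam p (hP i hi) (h𝔫eq i hi) (hres i hi) (hli i hi) (hdim i hi) hc ha₀ hμ (hw𝔫 i hi) (hf i hi)
  choose! g hg using hbirth
  have ha₀' : -a₀ ≠ 0 := neg_ne_zero.mpr ha₀
  exact ⟨descent_le_sub_two p ha₀' hlam hδ hlam' s P g d' hP hne hd'1 hg, descent_lt p ha₀' hlam hδ hlam' s P g d' hP hne hd'1 hg⟩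

/-- **Over a perfect residue field** the corner is empty: either `λ′ ≠ 0` and `birth_descent_intrinsic` applies, or `(−v(c))·λ = H^p` and no point of `Γ″` has finite
birth order. [cite: CossartPiltant2008, Prop. 4.4 (proof, p. 11)] -/
theorem birth_descent_intrinsic_perfect [PerfectRing k p] {c : k} (hc : c ≠ 0) {a₀ : k} (ha₀ : a₀ ≠ 0) (lam : k[X]) {μ δ : ℕ}
    (hμ : 0 < μ) (hlam : lam.natDegree ≤ δ) (hδ : (δ : k) = 0)
    (P : ι → k[X]) (hP : ∀ i ∈ s, Prime (P i)) (hne : ∀ i ∈ s, ∀ j ∈ s, i ≠ j → ¬ P i ∣ P j)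
    (G : ∀ i, Si i) (d' : ι → ℕ) (hd'1 : ∀ i ∈ s, 1 ≤ d' i)
    (h𝔫eq : ∀ i ∈ s, maximalIdeal (Si i) = (Ideal.span ({C (P i), X + C lam} : Set (k[X])[X])).map (algebraMap (k[X])[X] (Si i)))
    (hres : ∀ i ∈ s, ∀ z : Si i, ∃ g : k[X], z - algebraMap (k[X])[X] (Si i) (C g) ∈ maximalIdeal (Si i))
    (hli : ∀ i ∈ s, ∀ α β : Si i, α * algebraMap (k[X])[X] (Si i) (C (P i)) + β * algebraMap (k[X])[X] (Si i) (X + C lam) ∈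
      maximalIdeal (Si i) ^ 2 → α ∈ maximalIdeal (Si i) ∧ β ∈ maximalIdeal (Si i))
    (hdim : ∀ i ∈ s, ringKrullDim (Si i) = 2)
    (hw𝔫 : ∀ i ∈ s, algebraMap (k[X])[X] (Si i) (C (C a₀) * X) - G i ^ p ∈ maximalIdeal (Si i))
    (hf : ∀ i ∈ s, algebraMap (k[X])[X] (Si i) (C (C c) * (X + C lam) ^ μ) ∈
      Ideal.span {algebraMap (k[X])[X] (Si i) (C (C a₀) * X) - G i ^ p} ⊔ maximalIdeal (Si i) ^ (μ * d' i)) :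
    ((∑ i ∈ s, (d' i - 1) * (P i).natDegree ≤ δ - 2) ∧ ∀ i ∈ s, d' i ≤ δ - 1) ∨
      ∃ H : k[X], C (-a₀) * lam = H ^ p ∧ ∀ (𝔞 : Ideal k[X]) (n : ℕ), C (-a₀) * lam * 1 ^ p + (-H) ^ p ∈ 𝔞 ^ n := by
  by_cases hlam' : derivative lam = 0
  · right
    obtain ⟨H, hH, hmem⟩ := exists_eq_pow_of_restriction_of_derivative_eq_zero p (RingHom.id k[X]) (U := C (-a₀) * lam)
      (a₀ := -a₀) (lam := lam) rfl hlam'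
    exact ⟨H, hH, hmem⟩
  · exact Or.inl (birth_descent_intrinsic p s Si hc ha₀ lam hμ hlam hδ hlam' P hP hne G d' hd'1 h𝔫eq hres hli hdim hw𝔫 hf)

end Intrinsic

end Summit.ResolutionOfSingularities.ResolutionOfSingularities.Theorems.RadicialJung.CleanModels

end
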